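import Summits.QuantumFields.YangMills.Theorems.BalabanUVNodesK0HalvingStepOfCoreFloor
import Summits.QuantumFields.YangMills.Theorems.BalabanUVNodesN07LocalLettersCoreGuarded
import Summits.QuantumFields.YangMills.Theorems.BalabanUVNodesN07Prop8StepFlatWitness

/-!
# K0⁷ — THE GUARDED CHAIN END TO END: from the S6 head's per-datum G-tokens (dag-n07-w4 `…N07LocalLettersCoreGuarded`) to Proposition 8's guarded top step
# `Prop8RegSepTopStepG Adm` under ANY prefix guard `Adm : StepGuard F`, and the NON-VACUITY WITNESSES of the guarded ∕ floor-carrying core tokens (A6, ref-G READ340 NOTE-1)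

Cell `pub-ymgap`, seat `pub-ymgap-k0-s1-w3` generation 6 (D-0149 width seat 3∕3 on K0⁷ `stmt-QuantumFields-20541`, V19 stub 1 `stub_prop8StepCoP13`; CLAIM-2 of 2026-08-28).
`--kind proof --supports stmt-QuantumFields-20541 --as helper`.  NEW leaf, THEOREMS ONLY (0 def); CONSUMED BY NAME, nothing modified: this seat's CLAIM-1 `…K0HalvingStepOfCoreFloor`
(`prop8RegSepTopStepG_of_coreG`, `prop8RegSepTopStepR_of_coreR`), dag-n07-w4's `…N07LocalLettersCoreGuarded` (`LocalLetters165TopStepCoreG`, `LocalLettersSplitTopStepCoreG`, `DatumGauge165TopStepCoreG`,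
`DatumGaugeSplitTopStepCoreG`, `halvingStepTopCoreG_of_localLetters165CoreG`, `halvingStepTopCoreG_of_localLettersSplitCoreG`, `halvingStepTopCoreG_of_datumGauge165CoreG`,
`halvingStepTopCoreG_of_datumGaugeSplitCoreG`), dag-n07-e modules 46∕47 (`HalvingStepTopCoreR`, `HalvingStepTopCoreG`, `StepGuard`, `floorGuard`, `Prop8RegSepTopStepG`), p586684 §4
(`halvingStepTopCore_binders_inhabited_flat` — dag-n07-e module 32's flat witness with the core conclusion).  [15] = [Balaban1985Variational]; [6] = [Balaban1985RegularSpaces].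

WHY.  (1) dag-n07-w4's CLAIM-8 ∕ INTENT-9 typed the head's four S6 tokens in module 47's guard-generic currency with their compositions into `HalvingStepTopCoreG Adm`; with CLAIM-1 §3
(`HalvingStepTopCoreG Adm ⇒ HalvingStepTopG Adm ⇒ Prop8RegSepTopStepG Adm`) the guarded chain is end to end — §1 states it as ONE importable theorem per token, so the K0 skeleton's (R-b)
text, whichever CONCRETE guard it names (`floorGuard F c`, the head's level guard, or their conjunction), composes in one line.  (2) ref-G READ340 NOTE-1: «the K0 skeleton must name a CONCRETE
guard … plus a NON-VACUITY WITNESS; never a free∕∃ `Adm`» — §2 gives the A6 witnesses: for every guard holding at the witness data (in particular `floorGuard F c` at any `ν` with `c ≤ ν.M₁`)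
the binder block of `HalvingStepTopCoreG … Adm …` (resp. `HalvingStepTopCoreR … c …`) AND its conclusion are jointly inhabited by dag-n07-e module 32's flat datum (p586684 §4 BY NAME).

WHAT THIS FILE PROVES (kernel, sorry-free, standard axioms).
* §1 at the support of record, under ANY `Adm : StepGuard F`, with the registered floor `2L² ≤ B₃` and the smallness letters of p621398 ∕ `…CoreGuarded` verbatim:
  ★★ `prop8RegSepTopStepG_of_localLetters165CoreG` · ★★ `prop8RegSepTopStepG_of_localLettersSplitCoreG` · ★★★ `prop8RegSepTopStepG_of_datumGauge165CoreG` · ★★★ `prop8RegSepTopStepG_of_datumGaugeSplitCoreG`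
  — `DatumGaugeSplitTopStepCoreG Adm ⇒ LocalLettersSplitTopStepCoreG Adm ⇒ HalvingStepTopCoreG Adm ⇒ HalvingStepTopG Adm ⇒ Prop8RegSepTopStepG Adm`.
* §2 A6: ★ `halvingStepTopCoreG_binders_inhabited_flat` (any `Sup`, `0 < B₃`, `0 < a₀`, `0 < a₁`, `0 < ν.M₁`, `1 ≤ M`, `1 ≤ k`, and `hAdm : ∀ s, Adm ν M g K k s` — the guard holds at the
  witness numerics) · ★ `halvingStepTopCoreR_binders_inhabited_flat` (`c ≤ ν.M₁`) · `floorGuard_holds_of_le` (the floor guard's instance of `hAdm`).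

HONEST SCOPE ∕ A6.  CONDITIONAL compositions (§1): every antecedent token is the open analytic content of [15] Sect. F at NODE 00's objects — displayed, NEVER asserted, NOT proved here; §2
shows their binder blocks are inhabited together with the core conclusion (flat datum `W ≡ 1`, `U ≡ 1`), so §1 and CLAIM-1 are not vacuous; the ∀-tokens themselves are NOT claimed.
Count-neutral; `stub_prop8StepCoP13` ∕ K0⁷ NOT closed; N07 NOT discharged; counts unmoved (28∕28 · 5∕27); one finite 𝕋⁴ programme at fixed ε; R4 closes the conditional finite-𝕋⁴ rung
`BalabanLadder.UV` only — the YM mass gap (Clay) is NOT proved by any of this; nothing continuum ∕ ℝ⁴ ∕ OS.  No `def` ∕ `instance` ∕ `notation` ∕ `sorry`.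
v-edition (director-ym №365 (2)–(4), row group 13′ — import line + PRIVATE re-home + every existing declaration BYTE-IDENTICAL; lint-clean in place; pen dag-n07-e g34 on the
director's word): `open ….K0HalvingStepOfCore (halvingStepTopCore_binders_inhabited_flat)` dropped — that module is residue after the Stage-2 seam (socket-typed §3) — and §2′ carries a
PRIVATE verbatim copy of the A6 witness on `import …N07Prop8StepFlatWitness`; with `…OfCoreFloor`'s matching v-edition this file's import closure meets no residue module.
-/

noncomputable section

namespace Summit.QuantumFields.YangMills.Theorems.K0HalvingStepOfCoreGuardedChain

open scoped Matrix.Norms.L2Operator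
open Literature.MathematicalPhysics.QuantumFieldTheory.Balaban1983to89
open Literature.MathematicalPhysics.QuantumFieldTheory.Balaban1983to89.Node00
open Literature.MathematicalPhysics.QuantumFieldTheory.Balaban1983to89.T4Continuum
open Literature.MathematicalPhysics.QuantumFieldTheory.Balaban1983to89.FlowStep
open B15DeterminingSets
open Summit.QuantumFields.YangMills.BalabanUVNodes.N07Prop8StepFlatWitness (halvingStepTop_binders_inhabited_flat)
open Summit.QuantumFields.YangMills.Theorems.K0HalvingStepOfCoreFloor (prop8RegSepTopStepG_of_coreG)
open Summit.QuantumFields.YangMills.BalabanUVNodes.N07LocalLettersCoreGuarded (LocalLetters165TopStepCoreG LocalLettersSplitTopStepCoreG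
  DatumGauge165TopStepCoreG DatumGaugeSplitTopStepCoreG halvingStepTopCoreG_of_localLetters165CoreG halvingStepTopCoreG_of_localLettersSplitCoreG
  halvingStepTopCoreG_of_datumGauge165CoreG halvingStepTopCoreG_of_datumGaugeSplitCoreG)

/-! ## §1  The guarded chain END TO END from the S6 head's per-datum G-tokens, at the support of record -/

section ChainG

variable {F : T4Family} {N : ℕ} [NeZero N]

/-- ★★ **THE (165)-LETTER TOKEN UNDER A GUARD CLOSES PROP. 8's TOP STEP UNDER THE SAME GUARD** at the support of record: `LocalLetters165TopStepCoreG Adm ⇒ Prop8RegSepTopStepG Adm` under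
`128C ≤ B₃`, `512θ ≤ 1`, `0 ≤ Q`, `512Q·a₀ ≤ 1`, `2a₀ ≤ 1` and the registered floor `2L² ≤ B₃`. [cite: Balaban1985Variational, (165)–(168) p.304, Prop. 8 p.304; Balaban1985RegularSpaces, (1.7)–(1.9) p.77; Balaban1987RG1, (0.1) p.251] -/
theorem prop8RegSepTopStepG_of_localLetters165CoreG {Adm : StepGuard F} {B₃ C θ Q a₀ a₁ : ℝ}
    (h : LocalLetters165TopStepCoreG F N (fun ν K Ω => suppDomOfRecord F ν K Ω) Adm B₃ C θ Q a₀ a₁) (hB₃ : 2 * (F.L : ℝ) ^ 2 ≤ B₃) (hC : 128 * C ≤ B₃)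
    (hθ' : 512 * θ ≤ 1) (hQ : 0 ≤ Q) (ha : 512 * Q * a₀ ≤ 1) (ha₀ : 2 * a₀ ≤ 1) :
    Prop8RegSepTopStepG F N (fun ν K Ω => suppDomOfRecord F ν K Ω) Adm B₃ a₀ a₁ :=
  have hB₃0 : 0 ≤ B₃ := (mul_nonneg zero_le_two (sq_nonneg _)).trans hB₃
  prop8RegSepTopStepG_of_coreG hB₃ (halvingStepTopCoreG_of_localLetters165CoreG h hB₃0 hC hθ' hQ ha ha₀)

/-- ★★ **THE SPLIT-LETTER TOKEN UNDER A GUARD CLOSES PROP. 8's TOP STEP UNDER THE SAME GUARD, ROAD R0′** at the support of record: `LocalLettersSplitTopStepCoreG Adm ⇒ Prop8RegSepTopStepG Adm`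
under `4C ≤ B₃`, `16θ ≤ 1`, `0 ≤ Q`, `0 ≤ κ`, `(16Q + 1024κ²)·a₀ ≤ 1`, `32κ·a₀ ≤ 1` and `2L² ≤ B₃`. [cite: Balaban1985Variational, (165)–(168) p.304, Prop. 8 p.304; Balaban1985RegularSpaces, (1.7)–(1.9) p.77, (1.54) p.85] -/
theorem prop8RegSepTopStepG_of_localLettersSplitCoreG {Adm : StepGuard F} {B₃ C θ Q κ a₀ a₁ : ℝ}
    (h : LocalLettersSplitTopStepCoreG F N (fun ν K Ω => suppDomOfRecord F ν K Ω) Adm B₃ C θ Q κ a₀ a₁) (hB₃ : 2 * (F.L : ℝ) ^ 2 ≤ B₃) (hC : 4 * C ≤ B₃)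
    (hθ : 16 * θ ≤ 1) (hQ : 0 ≤ Q) (hκ : 0 ≤ κ) (ha : (16 * Q + 1024 * κ ^ 2) * a₀ ≤ 1) (hκa : 32 * κ * a₀ ≤ 1) :
    Prop8RegSepTopStepG F N (fun ν K Ω => suppDomOfRecord F ν K Ω) Adm B₃ a₀ a₁ :=
  have hB₃0 : 0 ≤ B₃ := (mul_nonneg zero_le_two (sq_nonneg _)).trans hB₃
  prop8RegSepTopStepG_of_coreG hB₃ (halvingStepTopCoreG_of_localLettersSplitCoreG h hB₃0 hC hθ hQ hκ ha hκa)

/-- ★★★ **END TO END UNDER A GUARD, (165) ROAD: THE HEAD's PER-DATUM (165)-GAUGE TOKEN UNDER A GUARD CLOSES PROP. 8's TOP STEP UNDER THE SAME GUARD** at the support of record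
(`Mc ≥ 1`, `ρ ≥ L`): `DatumGauge165TopStepCoreG Adm ⇒ LocalLetters165TopStepCoreG Adm ⇒ HalvingStepTopCoreG Adm ⇒ HalvingStepTopG Adm ⇒ Prop8RegSepTopStepG Adm`.
[cite: Balaban1985Variational, p.302, (165)–(168) p.304, Prop. 8 p.304, Sect. F pp.300–304; Balaban1985RegularSpaces, (1.7)–(1.9) p.77; Balaban1987RG1, (0.1) p.251] -/
theorem prop8RegSepTopStepG_of_datumGauge165CoreG {Mc ρ : ℕ} {Adm : StepGuard F} (hMc : 1 ≤ Mc) (hρ : F.L ≤ ρ) {B₃ C θ Q a₀ a₁ : ℝ}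
    (h : DatumGauge165TopStepCoreG F N (fun ν K Ω => suppDomOfRecord F ν K Ω) Mc ρ Adm B₃ C θ Q a₀ a₁) (hB₃ : 2 * (F.L : ℝ) ^ 2 ≤ B₃) (hC : 128 * C ≤ B₃)
    (hθ' : 512 * θ ≤ 1) (hQ : 0 ≤ Q) (ha : 512 * Q * a₀ ≤ 1) (ha₀ : 2 * a₀ ≤ 1) :
    Prop8RegSepTopStepG F N (fun ν K Ω => suppDomOfRecord F ν K Ω) Adm B₃ a₀ a₁ :=
  have hB₃0 : 0 ≤ B₃ := (mul_nonneg zero_le_two (sq_nonneg _)).trans hB₃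
  prop8RegSepTopStepG_of_coreG hB₃ (halvingStepTopCoreG_of_datumGauge165CoreG hMc hρ h hB₃0 hC hθ' hQ ha ha₀)

/-- ★★★ **END TO END UNDER A GUARD, ROAD R0′: THE HEAD's PER-DATUM SPLIT-GAUGE TOKEN UNDER A GUARD CLOSES PROP. 8's TOP STEP UNDER THE SAME GUARD** at the support of record
(`Mc ≥ 1`, `ρ ≥ L`): `DatumGaugeSplitTopStepCoreG Adm ⇒ LocalLettersSplitTopStepCoreG Adm ⇒ HalvingStepTopCoreG Adm ⇒ HalvingStepTopG Adm ⇒ Prop8RegSepTopStepG Adm` — the guarded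
chain of LOCATED-STUB1-FLOOR's repair by name, for whichever CONCRETE guard the K0 skeleton's (R-b) text names (ref-G READ340 NOTE-1).
[cite: Balaban1985Variational, p.302, (165)–(168) p.304, Prop. 8 p.304, Sect. F pp.300–304; Balaban1985RegularSpaces, (1.7)–(1.9) p.77, (1.54) p.85; Balaban1987RG1, (0.1) p.251] -/
theorem prop8RegSepTopStepG_of_datumGaugeSplitCoreG {Mc ρ : ℕ} {Adm : StepGuard F} (hMc : 1 ≤ Mc) (hρ : F.L ≤ ρ) {B₃ C θ Q κ a₀ a₁ : ℝ}
    (h : DatumGaugeSplitTopStepCoreG F N (fun ν K Ω => suppDomOfRecord F ν K Ω) Mc ρ Adm B₃ C θ Q κ a₀ a₁) (hB₃ : 2 * (F.L : ℝ) ^ 2 ≤ B₃) (hC : 4 * C ≤ B₃)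
    (hθ : 16 * θ ≤ 1) (hQ : 0 ≤ Q) (hκ : 0 ≤ κ) (ha : (16 * Q + 1024 * κ ^ 2) * a₀ ≤ 1) (hκa : 32 * κ * a₀ ≤ 1) :
    Prop8RegSepTopStepG F N (fun ν K Ω => suppDomOfRecord F ν K Ω) Adm B₃ a₀ a₁ :=
  have hB₃0 : 0 ≤ B₃ := (mul_nonneg zero_le_two (sq_nonneg _)).trans hB₃
  prop8RegSepTopStepG_of_coreG hB₃ (halvingStepTopCoreG_of_datumGaugeSplitCoreG hMc hρ h hB₃0 hC hθ hQ hκ ha hκa)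

end ChainG

/-! ## §2′  PRIVATE RE-HOME of p586684 §4 (director-ym №365 (2)–(4), row group 13′; statement + proof verbatim, `private`) -/

section RehomedWitness

variable (F : T4Family) (N : ℕ) [NeZero N]

/-- PRIVATE RE-HOME (director-ym №365 (2)–(4), row group 13′; R556): verbatim copy of `Summit.QuantumFields.YangMills.Theorems.K0HalvingStepOfCore.halvingStepTopCore_binders_inhabited_flat` — its module `…K0HalvingStepOfCore (p586684)` is residue after the Stage-2 seam and can no longer be imported on a green road; statement and proof byte-identical to the original, visibility `private` (no new public name, nothing restated for citers). -/
private theorem halvingStepTopCore_binders_inhabited_flat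
    (Sup : (ν : Stage7Numerics) → (K : ℕ) → (ℕ → Set (Site (F.P K) 0)) → Set (Site (F.P K) 0)) {B₃ a₀ a₁ : ℝ} (hB₃ : 0 < B₃) (ha₀ : 0 < a₀)
    (ha₁ : 0 < a₁) (ν : Stage7Numerics) (hM₁ : 0 < ν.M₁) {M : ℕ} (hM : 1 ≤ M) (g : ℕ → ℝ) (K k : ℕ) (hk : 1 ≤ k) :
    ∃ (s : SeqOfRecord F ν M g K k) (ε δ : ℕ → ℝ) (W : MSField (F.P K) (SU N)) (U : GaugeField (F.P K) 0 (SU N)),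
      Sect2.SeqSeparated ν.M₁ s ∧ 0 < ν.M₁ ∧ 1 ≤ k ∧
      (∀ n, n ≤ k → 0 < δ n ∧ δ n ≤ a₁) ∧ (∀ n, n < k → δ n ≤ 2 * δ (n + 1)) ∧ (∀ n, n < k → δ (n + 1) ≤ 2 * δ n) ∧
      (∀ n, n ≤ k → B₃ * δ n ≤ ε n ∧ ε n ≤ a₀) ∧ (∀ n, n < k → ε n ≤ 2 * ε (n + 1)) ∧ (∀ n, n < k → ε (n + 1) ≤ 2 * ε n) ∧
      Sect2.DataSmall7PTop (avOfRecord F N K) s.Ω (Sup ν K s.Ω) k δ W ∧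
      (∀ n, n ≤ k → PlaqSmallOn (Sect2.omegaPlaqsTop s.Ω (Sup ν K s.Ω) n) (ε n * (F.P K).eta n ^ 2) U) ∧
      (∀ n, n ≤ k → Sect2.CoDivSmallOn (Sect2.omegaBondsTop s.Ω (Sup ν K s.Ω) n) (ε n * (F.P K).eta n ^ 3) U) ∧
      AgreeOn (genSet s.Ω k) (avgFamily (avOfRecord F N K) U) W ∧ IsCritOnFibre F N K (genSet s.Ω k) W U ∧
      ((∀ n, n ≤ k → ∀ p ∈ Sect2.omegaPlaqsTop s.Ω (Sup ν K s.Ω) n, p ∉ Sect2.printedPlaqs s.Ω k 0 →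
          dist1 (GaugeField.plaqHol U p) < max (B₃ * δ n) (ε n / 2) * (F.P K).eta n ^ 2) ∧
        ∀ n, n ≤ k → ∀ b ∈ Sect2.omegaBondsTop s.Ω (Sup ν K s.Ω) n, b ∉ Sect2.bondsDeep (s.Ω 1)ᶜ →
          ‖Sect2.coDivSum U b.src b.dir‖ < max (B₃ * δ n) (ε n / 2) * (F.P K).eta n ^ 3) := by
  obtain ⟨s, ε, δ, W, U, hsep, hM₁', hk', hδ, hc, hc', hε, hec, hec', h7, h17, h19, hfib, hcrit, hP, hD⟩ :=
    halvingStepTop_binders_inhabited_flat F N Sup hB₃ ha₀ ha₁ ν hM₁ hM g K k hk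
  exact ⟨s, ε, δ, W, U, hsep, hM₁', hk', hδ, hc, hc', hε, hec, hec', h7, h17, h19, hfib, hcrit,
    fun n hn p hp _ => hP n hn p hp, fun n hn b hb _ => hD n hn b hb⟩

end RehomedWitness

/-! ## §2  A6: the guarded ∕ floor-carrying core token's binder block and conclusion are jointly inhabited (the flat datum, p586684 §4 BY NAME) -/

section WitnessG

variable (F : T4Family) (N : ℕ) [NeZero N]

/-- ★ **NON-VACUITY OF THE GUARDED CORE TOKEN's SHAPE** (A6; ref-G READ340 NOTE-1): for every top domain `Sup`, every prefix guard `Adm`, constants `B₃ > 0`, `a₀, a₁ > 0`, and data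
`ν` (`0 < M₁`), `M ≥ 1`, `g`, `K`, `k ≥ 1` AT WHICH THE GUARD HOLDS for every index (`hAdm : ∀ s, Adm ν M g K k s` — e.g. `floorGuard F c` at `c ≤ ν.M₁`, or a level guard in `k, K`
at admissible exponents), there are an index `s`, radii `ε`, thresholds `δ`, a datum `W` and a configuration `U` meeting ALL binders of `HalvingStepTopCoreG F N Sup Adm B₃ a₀ a₁` —
the guard included — AND its conclusion (dag-n07-e's flat witness through p586684 §4).  The ∀-token itself is [15] Sect. F's content and is NOT asserted.
[cite: Balaban1985Variational, Sect. F p.304, (2),(7) p.278 (bookkeeping); Balaban1987RG1, (0.1) p.251] -/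
theorem halvingStepTopCoreG_binders_inhabited_flat
    (Sup : (ν : Stage7Numerics) → (K : ℕ) → (ℕ → Set (Site (F.P K) 0)) → Set (Site (F.P K) 0)) {Adm : StepGuard F} {B₃ a₀ a₁ : ℝ} (hB₃ : 0 < B₃)
    (ha₀ : 0 < a₀) (ha₁ : 0 < a₁) (ν : Stage7Numerics) (hM₁ : 0 < ν.M₁) {M : ℕ} (hM : 1 ≤ M) (g : ℕ → ℝ) (K k : ℕ) (hk : 1 ≤ k)
    (hAdm : ∀ s : SeqOfRecord F ν M g K k, Adm ν M g K k s) :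
    ∃ (s : SeqOfRecord F ν M g K k) (ε δ : ℕ → ℝ) (W : MSField (F.P K) (SU N)) (U : GaugeField (F.P K) 0 (SU N)),
      Sect2.SeqSeparated ν.M₁ s ∧ 0 < ν.M₁ ∧ Adm ν M g K k s ∧ 1 ≤ k ∧
      (∀ n, n ≤ k → 0 < δ n ∧ δ n ≤ a₁) ∧ (∀ n, n < k → δ n ≤ 2 * δ (n + 1)) ∧ (∀ n, n < k → δ (n + 1) ≤ 2 * δ n) ∧
      (∀ n, n ≤ k → B₃ * δ n ≤ ε n ∧ ε n ≤ a₀) ∧ (∀ n, n < k → ε n ≤ 2 * ε (n + 1)) ∧ (∀ n, n < k → ε (n + 1) ≤ 2 * ε n) ∧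
      Sect2.DataSmall7PTop (avOfRecord F N K) s.Ω (Sup ν K s.Ω) k δ W ∧
      (∀ n, n ≤ k → PlaqSmallOn (Sect2.omegaPlaqsTop s.Ω (Sup ν K s.Ω) n) (ε n * (F.P K).eta n ^ 2) U) ∧
      (∀ n, n ≤ k → Sect2.CoDivSmallOn (Sect2.omegaBondsTop s.Ω (Sup ν K s.Ω) n) (ε n * (F.P K).eta n ^ 3) U) ∧
      AgreeOn (genSet s.Ω k) (avgFamily (avOfRecord F N K) U) W ∧ IsCritOnFibre F N K (genSet s.Ω k) W U ∧
      ((∀ n, n ≤ k → ∀ p ∈ Sect2.omegaPlaqsTop s.Ω (Sup ν K s.Ω) n, p ∉ Sect2.printedPlaqs s.Ω k 0 →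
          dist1 (GaugeField.plaqHol U p) < max (B₃ * δ n) (ε n / 2) * (F.P K).eta n ^ 2) ∧
        ∀ n, n ≤ k → ∀ b ∈ Sect2.omegaBondsTop s.Ω (Sup ν K s.Ω) n, b ∉ Sect2.bondsDeep (s.Ω 1)ᶜ →
          ‖Sect2.coDivSum U b.src b.dir‖ < max (B₃ * δ n) (ε n / 2) * (F.P K).eta n ^ 3) := by
  obtain ⟨s, ε, δ, W, U, hsep, hM₁', hk', hδ, hc, hc', hε, hec, hec', h7, h17, h19, hfib, hcrit, hPD⟩ :=
    halvingStepTopCore_binders_inhabited_flat F N Sup hB₃ ha₀ ha₁ ν hM₁ hM g K k hk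
  exact ⟨s, ε, δ, W, U, hsep, hM₁', hAdm s, hk', hδ, hc, hc', hε, hec, hec', h7, h17, h19, hfib, hcrit, hPD⟩

/-- **THE FLOOR GUARD HOLDS AT EVERY INDEX once `c ≤ ν.M₁`** (the `hAdm` instance for `Adm := floorGuard F c`). [cite: Balaban1985RegularSpaces, (1.3)–(1.6) p.77 (bookkeeping)] -/
theorem floorGuard_holds_of_le {c : ℕ} {ν : Stage7Numerics} (hc : c ≤ ν.M₁) (M : ℕ) (g : ℕ → ℝ) (K k : ℕ) :
    ∀ s : SeqOfRecord F ν M g K k, floorGuard F c ν M g K k s :=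
  fun _ => hc

/-- ★ **NON-VACUITY OF THE FLOOR-CARRYING CORE TOKEN's SHAPE** (A6): for every `Sup`, floor `c`, `B₃ > 0`, `a₀, a₁ > 0`, and numerics `ν` with `c ≤ ν.M₁` (and `0 < M₁`), `M ≥ 1`,
`g`, `K`, `k ≥ 1`, the binder block of `HalvingStepTopCoreR F N Sup c B₃ a₀ a₁` — the floor binder included — AND its conclusion are jointly inhabited (p586684 §4).  The ∀-token is NOT asserted.
[cite: Balaban1985Variational, Sect. F p.304, (2),(7) p.278 (bookkeeping); Balaban1985RegularSpaces, (1.3)–(1.6) p.77] -/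
theorem halvingStepTopCoreR_binders_inhabited_flat
    (Sup : (ν : Stage7Numerics) → (K : ℕ) → (ℕ → Set (Site (F.P K) 0)) → Set (Site (F.P K) 0)) {c : ℕ} {B₃ a₀ a₁ : ℝ} (hB₃ : 0 < B₃)
    (ha₀ : 0 < a₀) (ha₁ : 0 < a₁) (ν : Stage7Numerics) (hM₁ : 0 < ν.M₁) (hcν : c ≤ ν.M₁) {M : ℕ} (hM : 1 ≤ M) (g : ℕ → ℝ) (K k : ℕ) (hk : 1 ≤ k) :
    ∃ (s : SeqOfRecord F ν M g K k) (ε δ : ℕ → ℝ) (W : MSField (F.P K) (SU N)) (U : GaugeField (F.P K) 0 (SU N)),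
      Sect2.SeqSeparated ν.M₁ s ∧ 0 < ν.M₁ ∧ c ≤ ν.M₁ ∧ 1 ≤ k ∧
      (∀ n, n ≤ k → 0 < δ n ∧ δ n ≤ a₁) ∧ (∀ n, n < k → δ n ≤ 2 * δ (n + 1)) ∧ (∀ n, n < k → δ (n + 1) ≤ 2 * δ n) ∧
      (∀ n, n ≤ k → B₃ * δ n ≤ ε n ∧ ε n ≤ a₀) ∧ (∀ n, n < k → ε n ≤ 2 * ε (n + 1)) ∧ (∀ n, n < k → ε (n + 1) ≤ 2 * ε n) ∧
      Sect2.DataSmall7PTop (avOfRecord F N K) s.Ω (Sup ν K s.Ω) k δ W ∧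
      (∀ n, n ≤ k → PlaqSmallOn (Sect2.omegaPlaqsTop s.Ω (Sup ν K s.Ω) n) (ε n * (F.P K).eta n ^ 2) U) ∧
      (∀ n, n ≤ k → Sect2.CoDivSmallOn (Sect2.omegaBondsTop s.Ω (Sup ν K s.Ω) n) (ε n * (F.P K).eta n ^ 3) U) ∧
      AgreeOn (genSet s.Ω k) (avgFamily (avOfRecord F N K) U) W ∧ IsCritOnFibre F N K (genSet s.Ω k) W U ∧
      ((∀ n, n ≤ k → ∀ p ∈ Sect2.omegaPlaqsTop s.Ω (Sup ν K s.Ω) n, p ∉ Sect2.printedPlaqs s.Ω k 0 →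
          dist1 (GaugeField.plaqHol U p) < max (B₃ * δ n) (ε n / 2) * (F.P K).eta n ^ 2) ∧
        ∀ n, n ≤ k → ∀ b ∈ Sect2.omegaBondsTop s.Ω (Sup ν K s.Ω) n, b ∉ Sect2.bondsDeep (s.Ω 1)ᶜ →
          ‖Sect2.coDivSum U b.src b.dir‖ < max (B₃ * δ n) (ε n / 2) * (F.P K).eta n ^ 3) :=
  halvingStepTopCoreG_binders_inhabited_flat F N Sup (Adm := floorGuard F c) hB₃ ha₀ ha₁ ν hM₁ hM g K k hk (floorGuard_holds_of_le F hcν M g K k)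

end WitnessG

/-! ## §3  v1.1 (g7; plan g86 WORD V20 = G): DOORS from the guarded chain's end tokens to the V20 option-G STUB-1 TEXT
`∃ (c c₀ : ℕ) (B₃ a₀ a₁ : ℝ), 2L² ≤ B₃ ∧ 0 < a₀ ∧ 0 < a₁ ∧ Prop8RegSepTopStepG F 2 suppDom (fun ν _M _g K k _s => c ≤ ν.M₁ ∧ k + c₀ ≤ F.m + K) B₃ a₀ a₁` (`N = 2`) — the G-editions of
p586684's `prop8StepCoP_of_core` ∕ n21-c's `prop8StepCoP_of_halvingStepTop` ∕ `prop8StepCoP_of_localLetters165` and of the R candidates `K0HalvingStepOfCoreFloor.prop8StepCoPR_of_coreR` ∕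
`…_of_datumGaugeSplitCoreR`: a seat landing the head's token under ANY guard `Adm` IMPLIED BY the registered two-letter guard at some `(c, c₀)` gets the stub text in one line. -/

section DoorsV20G

/-- ★ **V20-G STUB 1 FROM THE GUARDED CORE ONE-STEP SENTENCE AT THE REGISTERED GUARD** (`N = 2`, support of record; §1's `prop8RegSepTopStepG_of_coreG`).  CONDITIONAL; the V20 text is
NOT registered here. [cite: Balaban1985Variational, Prop. 8 p.304, Sect. F pp.300–304, p.304 lines 1–2 (bookkeeping); Balaban1987RG1, (0.1) p.251] -/
theorem prop8StepCoPG_of_coreG (F : T4Family)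
    (h : ∃ (c c₀ : ℕ) (B₃ a₀ a₁ : ℝ), 2 * (F.L : ℝ) ^ 2 ≤ B₃ ∧ 0 < a₀ ∧ 0 < a₁ ∧
      HalvingStepTopCoreG F 2 (fun ν K Ω => suppDomOfRecord F ν K Ω) (fun ν _M _g K k _s => c ≤ ν.M₁ ∧ k + c₀ ≤ F.m + K) B₃ a₀ a₁) :
    ∃ (c c₀ : ℕ) (B₃ a₀ a₁ : ℝ), 2 * (F.L : ℝ) ^ 2 ≤ B₃ ∧ 0 < a₀ ∧ 0 < a₁ ∧
      Prop8RegSepTopStepG F 2 (fun ν K Ω => suppDomOfRecord F ν K Ω) (fun ν _M _g K k _s => c ≤ ν.M₁ ∧ k + c₀ ≤ F.m + K) B₃ a₀ a₁ := by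
  obtain ⟨c, c₀, B₃, a₀, a₁, hB₃, ha₀, ha₁, h⟩ := h
  exact ⟨c, c₀, B₃, a₀, a₁, hB₃, ha₀, ha₁, prop8RegSepTopStepG_of_coreG hB₃ h⟩

/-- ★ **V20-G STUB 1 FROM THE GUARDED CORE ONE-STEP SENTENCE UNDER ANY GUARD THE REGISTERED ONE IMPLIES** (the head's natural guard — floor ∧ non-wrapping window — is implied by
`c ≤ ν.M₁ ∧ k + c₀ ≤ F.m + K` at the head's choice of `(c, c₀)`, dag-n07-e LEVEL-GUARD-ARITHMETIC; module 47 `Prop8RegSepTopStepG.of_imp`).  CONDITIONAL.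
[cite: Balaban1985Variational, Prop. 8 p.304, Sect. F pp.300–304 (bookkeeping); Balaban1987RG1, (0.1) p.251] -/
theorem prop8StepCoPG_of_coreG_of_imp (F : T4Family) {Adm : StepGuard F} {c c₀ : ℕ}
    (himp : ∀ (ν : Stage7Numerics) (M : ℕ) (g : ℕ → ℝ) (K k : ℕ) (s : SeqOfRecord F ν M g K k), c ≤ ν.M₁ ∧ k + c₀ ≤ F.m + K → Adm ν M g K k s)
    (h : ∃ (B₃ a₀ a₁ : ℝ), 2 * (F.L : ℝ) ^ 2 ≤ B₃ ∧ 0 < a₀ ∧ 0 < a₁ ∧ HalvingStepTopCoreG F 2 (fun ν K Ω => suppDomOfRecord F ν K Ω) Adm B₃ a₀ a₁) :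
    ∃ (c c₀ : ℕ) (B₃ a₀ a₁ : ℝ), 2 * (F.L : ℝ) ^ 2 ≤ B₃ ∧ 0 < a₀ ∧ 0 < a₁ ∧
      Prop8RegSepTopStepG F 2 (fun ν K Ω => suppDomOfRecord F ν K Ω) (fun ν _M _g K k _s => c ≤ ν.M₁ ∧ k + c₀ ≤ F.m + K) B₃ a₀ a₁ := by
  obtain ⟨B₃, a₀, a₁, hB₃, ha₀, ha₁, h⟩ := h
  exact ⟨c, c₀, B₃, a₀, a₁, hB₃, ha₀, ha₁, (prop8RegSepTopStepG_of_coreG hB₃ h).of_imp himp⟩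

/-- ★ **V20-G STUB 1 FROM THE GUARDED ONE-PASS SENTENCE `HalvingStepTopG` UNDER ANY GUARD THE REGISTERED ONE IMPLIES** (module 47 `prop8RegSepTopStepG_of_halvingStepTopG`; `0 < B₃` from
`2L² ≤ B₃`) — the G-edition of n21-c's `K0HalvingStepSocket.prop8StepCoP_of_halvingStepTop`.  CONDITIONAL. [cite: Balaban1985Variational, Sect. F p.304, Prop. 8 p.304 (bookkeeping); Balaban1987RG1, (0.1) p.251] -/
theorem prop8StepCoPG_of_halvingStepTopG_of_imp (F : T4Family) {Adm : StepGuard F} {c c₀ : ℕ}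
    (himp : ∀ (ν : Stage7Numerics) (M : ℕ) (g : ℕ → ℝ) (K k : ℕ) (s : SeqOfRecord F ν M g K k), c ≤ ν.M₁ ∧ k + c₀ ≤ F.m + K → Adm ν M g K k s)
    (h : ∃ (B₃ a₀ a₁ : ℝ), 2 * (F.L : ℝ) ^ 2 ≤ B₃ ∧ 0 < a₀ ∧ 0 < a₁ ∧ HalvingStepTopG F 2 (fun ν K Ω => suppDomOfRecord F ν K Ω) Adm B₃ a₀ a₁) :
    ∃ (c c₀ : ℕ) (B₃ a₀ a₁ : ℝ), 2 * (F.L : ℝ) ^ 2 ≤ B₃ ∧ 0 < a₀ ∧ 0 < a₁ ∧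
      Prop8RegSepTopStepG F 2 (fun ν K Ω => suppDomOfRecord F ν K Ω) (fun ν _M _g K k _s => c ≤ ν.M₁ ∧ k + c₀ ≤ F.m + K) B₃ a₀ a₁ := by
  obtain ⟨B₃, a₀, a₁, hB₃, ha₀, ha₁, h⟩ := h
  have hL : (0 : ℝ) < (F.L : ℝ) := by exact_mod_cast lt_trans Nat.zero_lt_one F.hL.2
  have hB₃0 : (0 : ℝ) < B₃ := lt_of_lt_of_le (mul_pos two_pos (pow_pos hL 2)) hB₃
  exact ⟨c, c₀, B₃, a₀, a₁, hB₃, ha₀, ha₁, (prop8RegSepTopStepG_of_halvingStepTopG hB₃0 h).of_imp himp⟩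

/-- ★★ **V20-G STUB 1 FROM THE HEAD's PER-DATUM SPLIT-GAUGE TOKEN UNDER ANY GUARD THE REGISTERED ONE IMPLIES, ROAD R0′** (the STEP-7 ∃-introduction's output sentence with p621398∕p624743's
numeric side conditions; §1's `prop8RegSepTopStepG_of_datumGaugeSplitCoreG` then `.of_imp`) — the G-edition of `K0HalvingStepOfCoreFloor.prop8StepCoPR_of_datumGaugeSplitCoreR`.  CONDITIONAL.
[cite: Balaban1985Variational, p.302, (165)–(168) p.304, Prop. 8 p.304 (bookkeeping); Balaban1985RegularSpaces, (1.54) p.85; Balaban1987RG1, (0.1) p.251] -/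
theorem prop8StepCoPG_of_datumGaugeSplitCoreG_of_imp (F : T4Family) {Adm : StepGuard F} {c c₀ : ℕ}
    (himp : ∀ (ν : Stage7Numerics) (M : ℕ) (g : ℕ → ℝ) (K k : ℕ) (s : SeqOfRecord F ν M g K k), c ≤ ν.M₁ ∧ k + c₀ ≤ F.m + K → Adm ν M g K k s)
    (h : ∃ (Mc ρ : ℕ) (B₃ C θ Q κ a₀ a₁ : ℝ), 1 ≤ Mc ∧ F.L ≤ ρ ∧ 2 * (F.L : ℝ) ^ 2 ≤ B₃ ∧ 4 * C ≤ B₃ ∧ 16 * θ ≤ 1 ∧ 0 ≤ Q ∧ 0 ≤ κ ∧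
      (16 * Q + 1024 * κ ^ 2) * a₀ ≤ 1 ∧ 32 * κ * a₀ ≤ 1 ∧ 0 < a₀ ∧ 0 < a₁ ∧
      DatumGaugeSplitTopStepCoreG F 2 (fun ν K Ω => suppDomOfRecord F ν K Ω) Mc ρ Adm B₃ C θ Q κ a₀ a₁) :
    ∃ (c c₀ : ℕ) (B₃ a₀ a₁ : ℝ), 2 * (F.L : ℝ) ^ 2 ≤ B₃ ∧ 0 < a₀ ∧ 0 < a₁ ∧
      Prop8RegSepTopStepG F 2 (fun ν K Ω => suppDomOfRecord F ν K Ω) (fun ν _M _g K k _s => c ≤ ν.M₁ ∧ k + c₀ ≤ F.m + K) B₃ a₀ a₁ := by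
  obtain ⟨Mc, ρ, B₃, C, θ, Q, κ, a₀, a₁, hMc, hρ, hB₃, hC, hθ, hQ, hκ, ha, hκa, ha₀, ha₁, h⟩ := h
  exact ⟨c, c₀, B₃, a₀, a₁, hB₃, ha₀, ha₁, (prop8RegSepTopStepG_of_datumGaugeSplitCoreG hMc hρ h hB₃ hC hθ hQ hκ ha hκa).of_imp himp⟩

/-- ★ **V20-G STUB 1 FROM THE (165)-LETTER TOKEN UNDER ANY GUARD THE REGISTERED ONE IMPLIES** (§1's `prop8RegSepTopStepG_of_localLetters165CoreG` then `.of_imp`) — the G-edition of n21-c's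
`K0LocalLettersSocket.prop8StepCoP_of_localLetters165` ∕ this lineage's `K0LocalLettersCoreSocket.prop8StepCoP_of_localLetters165Core`.  CONDITIONAL.
[cite: Balaban1985Variational, (165)–(168) p.304, Prop. 8 p.304 (bookkeeping); Balaban1987RG1, (0.1) p.251] -/
theorem prop8StepCoPG_of_localLetters165CoreG_of_imp (F : T4Family) {Adm : StepGuard F} {c c₀ : ℕ}
    (himp : ∀ (ν : Stage7Numerics) (M : ℕ) (g : ℕ → ℝ) (K k : ℕ) (s : SeqOfRecord F ν M g K k), c ≤ ν.M₁ ∧ k + c₀ ≤ F.m + K → Adm ν M g K k s)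
    (h : ∃ (B₃ C θ Q a₀ a₁ : ℝ), 2 * (F.L : ℝ) ^ 2 ≤ B₃ ∧ 128 * C ≤ B₃ ∧ 512 * θ ≤ 1 ∧ 0 ≤ Q ∧ 512 * Q * a₀ ≤ 1 ∧ 2 * a₀ ≤ 1 ∧ 0 < a₀ ∧ 0 < a₁ ∧
      LocalLetters165TopStepCoreG F 2 (fun ν K Ω => suppDomOfRecord F ν K Ω) Adm B₃ C θ Q a₀ a₁) :
    ∃ (c c₀ : ℕ) (B₃ a₀ a₁ : ℝ), 2 * (F.L : ℝ) ^ 2 ≤ B₃ ∧ 0 < a₀ ∧ 0 < a₁ ∧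
      Prop8RegSepTopStepG F 2 (fun ν K Ω => suppDomOfRecord F ν K Ω) (fun ν _M _g K k _s => c ≤ ν.M₁ ∧ k + c₀ ≤ F.m + K) B₃ a₀ a₁ := by
  obtain ⟨B₃, C, θ, Q, a₀, a₁, hB₃, hC, hθ, hQ, ha, ha2, ha₀, ha₁, h⟩ := h
  exact ⟨c, c₀, B₃, a₀, a₁, hB₃, ha₀, ha₁, (prop8RegSepTopStepG_of_localLetters165CoreG h hB₃ hC hθ hQ ha ha2).of_imp himp⟩

end DoorsV20G

end Summit.QuantumFields.YangMills.Theorems.K0HalvingStepOfCoreGuardedChain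

end
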